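import Summits.BirchSwinnertonDyer.BirchSwinnertonDyer.Theorems.CMKolyvaginAtInertTwoInertOrderSplittingTower
import Literature.NumberTheory.EllipticCurves.IsogenyHasCMBaseChangeProofs
import HarnessLib

/-!
# Route `CMKolyvaginAtInertTwo`, crux `CMKolyvaginExactAtInertTwo` (stmt-BirchSwinnertonDyer-24277):
# stub S1 of the Morita frame — the equivariant CM generator over `K ∋ √Δ` IS (the map on points of) an
# ISOGENY of `E_K`, so the exact Selmer splitting holds modulo the tree's named fact
# `Isogeny.hasLocalPointsMaps` only

Seat `bsd-line-cmk2-p1` g10 (cell `bsd-print-cf2`); helper (`--supports stmt-BirchSwinnertonDyer-24277`).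
THEOREMS ONLY: no definition, no named fact, no `sorry`; no item is closed; BSD is not proved by this.
Memo `Cruxes/CMExactDescentAtTwo/MEMO-inert-order-splitting.md` §5 (stub S1).

* `isAlgebraicOn_conj_of_algEquiv` — FORWARD transport of algebraicity along `E(K̄) ≃ E_L(L̄)` induced
  by a `K`-isomorphism `ι : K̄ ≃ L̄` (the tree had the backward direction
  `isAlgebraicOn_conj_symm_of_algEquiv` and the case `L = K̄`, `isAlgebraicOn_conj`); corollary
  `hasCM_baseChange` (**CM is inherited by base change**, the converse of `HasCM.of_baseChange`).
* `exists_isogeny_cmGenerator` — for `j(E)` maximal CM with `d` odd and a number field `K ∋ √Δ_E`: an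
  `Isogeny (W⁄K) (W⁄K)` (tree structure: algebraic + `Γ_K`-equivariant + finite kernel) whose map `η`
  satisfies `η² − dη = −c`: Cox's `ι₀(ω_d)`, algebraic by `mem_geomEndRing_iff_holds`, transported along
  `RatClosure.pointsEquiv`, equivariant by `InertOrderSplittingHabitat` §1 + ty2's dichotomy.
* `natCard_selmer_eq_sq_of_isogenyLocalPointsMaps` — over the tower `ℚ ⊂ K_H ⊂ L` of the Morita frame
  (maximal orders): **`#Sel_{2^M}(E_L/L) = (#Sel_{2^M}(E_L/L)^{σ})²`** modulo ONLY the named fact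
  `Isogeny.hasLocalPointsMaps (W⁄L) (W⁄L)` (Silverman III.4: isogenies act on points over every field).

References: Silverman *AEC* III.§4 [SilvermanAEC2009]; Lang, *Elliptic Functions*, Ch. 10 §4 [Lang1987];
Cox, *Primes of the form x² + ny²*, Thm. 10.14, §14.B [Cox2013].
-/

-- single-conjunct summit: `Summit.BirchSwinnertonDyer.BirchSwinnertonDyer.…` repeats the name by design
set_option linter.dupNamespace false
set_option autoImplicit false

noncomputable section

open scoped Classical

namespace Summit.BirchSwinnertonDyer.BirchSwinnertonDyer.Theorems.InertOrderSplittingHabitat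

open WeierstrassCurve Field NumberField
open Literature.NumberTheory.EllipticCurves Literature.NumberTheory.EllipticCurves.Rank1Residual
open Literature.NumberTheory.GaloisRepresentations
open Summit.BirchSwinnertonDyer.Rank1Residual.P2.CartanAtTwo
open Summit.BirchSwinnertonDyer.BirchSwinnertonDyer.Theorems.KolyvaginImageTwo

universe u

/-! ## §1 Algebraicity transports FORWARD along base change -/

section Transport

variable {K : Type u} [Field K] (W : WeierstrassCurve K) {L : Type u} [Field L] [Algebra K L]

/-- **An algebraic additive endomorphism of `E(K̄)`, transported along `E(K̄) ≃ E_L(L̄)` induced by a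
`K`-isomorphism `ι : K̄ ≃ L̄`, is algebraic** (same rational map, coefficients pushed by `ι`).
[cite: SilvermanAEC2009, III.§4 (End(E) is attached to E/K̄)] -/
theorem isAlgebraicOn_conj_of_algEquiv (ι : AlgebraicClosure K ≃ₐ[K] AlgebraicClosure L)
    (e : W.geomPoints ≃+ (W.baseChange L).geomPoints)
    (he : ∀ P, e P = Affine.Point.map (W' := W) (ι : AlgebraicClosure K →ₐ[K] AlgebraicClosure L) P)
    {f : W.geomPoints →+ W.geomPoints} (hf : IsAlgebraicOn W W f) :
    IsAlgebraicOn (W.baseChange L) (W.baseChange L)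
      ((e.toAddMonoidHom.comp f).comp e.symm.toAddMonoidHom) := by
  set φ : AlgebraicClosure K →+* AlgebraicClosure L := (ι : AlgebraicClosure K →+* AlgebraicClosure L)
    with hφ
  have hφx : ∀ x, φ x = ι x := fun _ ↦ rfl
  have heval : ∀ (q : MvPolynomial (Fin 2) (AlgebraicClosure K)) (x y : AlgebraicClosure K),
      MvPolynomial.eval ![ι x, ι y] (q.map φ) = ι (MvPolynomial.eval ![x, y] q) := fun q x y ↦ by
    rw [← hφx x, ← hφx y]
    exact eval_map_ringHom_fin_two φ q x y
  obtain ⟨P₁, Q₁, P₂, Q₂, hfin⟩ := hf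
  refine ⟨P₁.map φ, Q₁.map φ, P₂.map φ, Q₂.map φ, ?_⟩
  refine (hfin.image e).subset fun Q hQ ↦ ?_
  obtain ⟨P, rfl⟩ := e.surjective Q
  refine ⟨P, fun hP ↦ hQ ?_, rfl⟩
  obtain ⟨x, y, h, rfl, hQ₁, hQ₂, h', hfP⟩ := hP
  have hx' : MvPolynomial.eval ![(ι : AlgebraicClosure K →ₐ[K] AlgebraicClosure L) x,
        (ι : AlgebraicClosure K →ₐ[K] AlgebraicClosure L) y] (P₁.map φ) /
      MvPolynomial.eval ![(ι : AlgebraicClosure K →ₐ[K] AlgebraicClosure L) x,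
        (ι : AlgebraicClosure K →ₐ[K] AlgebraicClosure L) y] (Q₁.map φ) =
      ι (MvPolynomial.eval ![x, y] P₁ / MvPolynomial.eval ![x, y] Q₁) := by
    change MvPolynomial.eval ![ι x, ι y] (P₁.map φ) / MvPolynomial.eval ![ι x, ι y] (Q₁.map φ) = _
    rw [heval, heval, map_div₀]
  have hy' : MvPolynomial.eval ![(ι : AlgebraicClosure K →ₐ[K] AlgebraicClosure L) x,
        (ι : AlgebraicClosure K →ₐ[K] AlgebraicClosure L) y] (P₂.map φ) /
      MvPolynomial.eval ![(ι : AlgebraicClosure K →ₐ[K] AlgebraicClosure L) x,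
        (ι : AlgebraicClosure K →ₐ[K] AlgebraicClosure L) y] (Q₂.map φ) =
      ι (MvPolynomial.eval ![x, y] P₂ / MvPolynomial.eval ![x, y] Q₂) := by
    change MvPolynomial.eval ![ι x, ι y] (P₂.map φ) / MvPolynomial.eval ![ι x, ι y] (Q₂.map φ) = _
    rw [heval, heval, map_div₀]
  have heP : e (.some x y h) = .some ((ι : AlgebraicClosure K →ₐ[K] AlgebraicClosure L) x)
      ((ι : AlgebraicClosure K →ₐ[K] AlgebraicClosure L) y)
      ((Affine.baseChange_nonsingular (W := W)
        (f := (ι : AlgebraicClosure K →ₐ[K] AlgebraicClosure L)) ι.injective x y).mpr h) := by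
    rw [he]; rfl
  refine ⟨_, _, _, heP, ?_, ?_, ?_⟩
  · change MvPolynomial.eval ![ι x, ι y] (Q₁.map φ) ≠ 0
    rw [heval]; exact (_root_.map_ne_zero ι).mpr hQ₁
  · change MvPolynomial.eval ![ι x, ι y] (Q₂.map φ) ≠ 0
    rw [heval]; exact (_root_.map_ne_zero ι).mpr hQ₂
  · refine ⟨?_, ?_⟩
    · rw [hx', hy']
      exact (Affine.baseChange_nonsingular (W := W)
        (f := (ι : AlgebraicClosure K →ₐ[K] AlgebraicClosure L)) ι.injective _ _).mpr h'
    · rw [AddMonoidHom.comp_apply, AddMonoidHom.comp_apply, AddEquiv.coe_toAddMonoidHom,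
        AddEquiv.coe_toAddMonoidHom, AddEquiv.symm_apply_apply, hfP, he, Affine.Point.map_some]
      exact Affine.Point.some.congr_simp _ _ hx'.symm _ _ hy'.symm _

/-- **CM is inherited by base change**: `End_{K̄}(E) ≠ ℤ ⟹ End_{L̄}(E_L) ≠ ℤ` for `L/K` algebraic (the
converse of the tree's `HasCM.of_baseChange`): a non-integer algebraic endomorphism transports to one.
[cite: SilvermanAEC2009, III.§4, Remark III.4.3] -/
theorem hasCM_baseChange [W.IsElliptic] [Algebra.IsAlgebraic K L] (hCM : W.HasCM) :
    (W.baseChange L).HasCM := by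
  haveI : (W.baseChange L).IsElliptic := by rw [baseChange]; infer_instance
  -- `HasCM` = some element of `geomEndRing` is not multiplication by an integer
  set ι := Literature.NumberTheory.EllipticCurves.absClosureEquiv K L with hι
  set e : W.geomPoints ≃+ (W.baseChange L).geomPoints :=
    { toFun := Affine.Point.map (W' := W) (ι : AlgebraicClosure K →ₐ[K] AlgebraicClosure L)
      invFun := Affine.Point.map (W' := W) (ι.symm : AlgebraicClosure L →ₐ[K] AlgebraicClosure K)
      left_inv := fun P ↦ by
        change (W.baseChange (AlgebraicClosure K)).toAffine.Point at P
        rcases P with _ | ⟨x, y, h⟩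
        · rfl
        · exact Affine.Point.some_eq_some_of_eq (ι.symm_apply_apply x) (ι.symm_apply_apply y)
      right_inv := fun Q ↦ by
        change ((W.baseChange L).baseChange (AlgebraicClosure L)).toAffine.Point at Q
        rcases Q with _ | ⟨x, y, h⟩
        · rfl
        · exact Affine.Point.some_eq_some_of_eq (ι.apply_symm_apply x) (ι.apply_symm_apply y)
      map_add' := map_add _ } with hedef
  unfold HasCM at hCM ⊢
  obtain ⟨f, hf, hfn⟩ := hCM
  rcases (W.mem_geomEndRing_iff_holds f).1 hf with h0 | halg
  · exact absurd (h0.trans Int.cast_zero.symm) (hfn 0)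
  · have halg' := isAlgebraicOn_conj_of_algEquiv W ι e (fun _ ↦ rfl) halg
    refine ⟨_, Subring.subset_closure halg', fun n hn ↦ hfn n ?_⟩
    refine DFunLike.ext _ _ fun P ↦ ?_
    have h0 : e (f (e.symm (e P))) = (n : AddMonoid.End (geomPoints (W.baseChange L))) (e P) :=
      congrArg (fun g : AddMonoid.End (geomPoints (W.baseChange L)) ↦ g (e P)) hn
    rw [AddEquiv.symm_apply_apply, AddMonoid.End.intCast_apply] at h0
    rw [AddMonoid.End.intCast_apply]
    apply e.injective
    rw [map_zsmul]
    exact h0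

end Transport

/-! ## §2 The equivariant CM generator over `K ∋ √Δ` is an isogeny of `E_K` -/

section IsogenyPackage

variable (W : WeierstrassCurve ℚ) [W.IsElliptic]

/-- **The CM generator over `K ∋ √Δ_E` as an `Isogeny (W⁄K) (W⁄K)`** (`j(E)` maximal CM, `d = cmDiscr j`
odd, `4c = d(d−1)`): Cox's `ι₀(ω_d) ∈ End_{ℚ̄}(E)` is algebraic (`mem_geomEndRing_iff_holds`; it is not
`0` since `−c` is odd), its transport along `RatClosure.pointsEquiv` is algebraic
(`isAlgebraicOn_conj_of_algEquiv`) and `Γ_K`-equivariant (every `γ ∈ Γ_K` is even on `E[2]` as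
`√Δ ∈ K`, and even elements commute with `ω_d` by ty2's dichotomy), with finite kernel; its map `η`
satisfies `η² − dη = −c`. [cite: SilvermanAEC2009, III.§4] [cite: Lang1987, Ch. 10 §4, Remark] -/
theorem exists_isogeny_cmGenerator (hj : W.j ∈ maximalCMJInvariants) {d c : ℤ}
    (hd : cmDiscr W.j = d) (hc : d * (d - 1) = 4 * c) (hodd : Odd d) (hoddc : Odd c)
    (K : Type) [Field K] [NumberField K] (hΔ : IsSquare (W.baseChange K).Δ) :
    ∃ φ : Isogeny (W.baseChange K) (W.baseChange K),
      ∀ P : geomPoints (W.baseChange K), φ (φ P) + (-d) • φ P = (-c) • P := by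
  haveI : (W.baseChange K).IsElliptic := by rw [baseChange]; infer_instance
  subst hd
  obtain ⟨η₀, hη₀, hrel₀⟩ := exists_cmGenerator_of_mem_maximalCMJInvariants W hj hc
  have hrel : ∀ P : geomPoints W, η₀ (η₀ P) + (-cmDiscr W.j) • η₀ P = (-c) • P := rel_apply W hrel₀
  have hcard : Nat.card (geomTorsion W ((2 : ℕ) : ℤ)) = 4 := by simpa using natCard_geomTorsion_two_pow W 1
  -- `η₀` is algebraic (it is not the zero map: `-c` is odd)
  have halg : IsAlgebraicOn W W η₀ := by
    rcases (W.mem_geomEndRing_iff_holds η₀).1 hη₀ with h0 | h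
    · exfalso
      obtain ⟨Q, hQ, h2Q⟩ := exists_two_torsion_ne_zero (V := W) hcard
      have h := hrel Q
      have hz : ∀ R : geomPoints W, (0 : AddMonoid.End (geomPoints W)) R = 0 := fun _ ↦ rfl
      simp only [h0, hz, smul_zero, add_zero, zsmul_eq_self_of_odd h2Q hoddc.neg] at h
      exact hQ h.symm
    · exact h
  set e := RatClosure.pointsEquiv (K := K) W with hedef
  have he : ∀ P, e P = Affine.Point.map (W' := W)
      ((Literature.NumberTheory.EllipticCurves.absClosureEquiv ℚ K).toAlgHom :
        AlgebraicClosure ℚ →ₐ[ℚ] AlgebraicClosure K) P := fun P ↦ rfl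
  have halg' := isAlgebraicOn_conj_of_algEquiv W (Literature.NumberTheory.EllipticCurves.absClosureEquiv ℚ K)
    e he halg
  have he' : ∀ (γ : absoluteGaloisGroup K) (Q : geomPoints (W.baseChange K)),
      e.symm (γ • Q) = absGaloisRestrict ℚ K γ • e.symm Q := fun γ Q ↦ by
    apply e.injective
    rw [hedef, RatClosure.pointsEquiv_smul, AddEquiv.apply_symm_apply, AddEquiv.apply_symm_apply]
  have h2K : (2 : K) ≠ 0 := two_ne_zero
  have hcomm : ∀ (γ : absoluteGaloisGroup K) (R : geomPoints W),
      absGaloisRestrict ℚ K γ • η₀ R = η₀ (absGaloisRestrict ℚ K γ • R) := by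
    intro γ
    rcases smul_trivial_or_fixedPointFree_of_isSquare_Δ (W.baseChange K) h2K hΔ γ with htriv | hfpf
    · refine commute_of_trivial hodd.neg hcard (dichotomy W hη₀ hrel₀ _) fun R h2R ↦ ?_
      apply e.injective
      rw [hedef, RatClosure.pointsEquiv_smul, htriv _ (by rw [← map_zsmul, h2R, map_zero])]
    · refine commute_of_fixedPointFree hrel hodd.neg hoddc.neg hcard (dichotomy W hη₀ hrel₀ _)
        fun R h2R hfix ↦ ?_
      have h : e R = 0 := hfpf (e R) (by rw [← map_zsmul, h2R, map_zero])
        (by rw [hedef, ← RatClosure.pointsEquiv_smul, hfix])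
      exact e.injective (by rw [h, map_zero])
  refine ⟨⟨(e.toAddMonoidHom.comp η₀).comp e.symm.toAddMonoidHom, halg', fun γ P ↦ ?_, halg'.finite_ker⟩,
    fun P ↦ ?_⟩
  · change e (η₀ (e.symm (γ • P))) = γ • e (η₀ (e.symm P))
    rw [he', ← hcomm, hedef, RatClosure.pointsEquiv_smul]
  · change e (η₀ (e.symm (e (η₀ (e.symm P))))) + (-cmDiscr W.j) • e (η₀ (e.symm P)) = (-c) • P
    rw [AddEquiv.symm_apply_apply, ← map_zsmul, ← map_add, hrel, map_zsmul, AddEquiv.apply_symm_apply]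

end IsogenyPackage

/-! ## §3 The tower theorem modulo the named fact `Isogeny.hasLocalPointsMaps` -/

section TowerIsogeny

variable (W : WeierstrassCurve ℚ) [W.IsElliptic] {L : Type} [Field L] [NumberField L]
variable {c₀ : absoluteGaloisGroup ℚ}

/-- **`#Sel_{2^M}(E_L/L) = (#Sel_{2^M}(E_L/L)^{σ})²` over the tower, modulo `Isogeny.hasLocalPointsMaps`
ONLY** (`j(E)` maximal CM with `d` odd, `Δ_E < 0`, `ρ̄_{E,2}` onto; `K` quadratic, `L ⊇ K` quadratic
over `K`, normal over `ℚ`, totally complex, `√Δ_E ∈ L`; `σ` = complex conjugation of `L`).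
[cite: Lang1987, Ch. 10 §4, Remark] [cite: SilvermanAEC2009, III.§4] [cite: MilneADT2006, I.§7] -/
theorem natCard_selmer_eq_sq_of_isogenyLocalPointsMaps [Normal ℚ L]
    (hj : W.j ∈ maximalCMJInvariants) {d c : ℤ} (hd : cmDiscr W.j = d) (hcd : d * (d - 1) = 4 * c)
    (hodd : Odd d) (hoddc : Odd c) (hΔ : W.Δ < 0) (hsurj : W.HasSurjectiveModNGaloisRep 2)
    (K : Type) [Field K] [NumberField K] (hK2 : Module.finrank ℚ K = 2) [Algebra K L]
    (hLK : Module.finrank K L = 2) (hLc : ∀ w : InfinitePlace L, w.IsComplex)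
    (hΔL : IsSquare (W.baseChange L).Δ) (hc₀ : IsComplexConjugation (Rat.castHom ℝ) c₀)
    (hX : Isogeny.hasLocalPointsMaps (W.baseChange L) (W.baseChange L)) (M : ℕ) :
    Nat.card (selmerGroup (W.baseChange L) ((2 : ℤ) ^ M)) =
      Nat.card {x : selmerGroup (W.baseChange L) ((2 : ℤ) ^ M) //
        conjAct W ((absGaloisTransport (K := ℚ) (L := L) c₀).restrictNormal L) _
          (x : galH1Torsion (W.baseChange L) ((2 : ℤ) ^ M)) = x} ^ 2 := by
  haveI : (W.baseChange L).IsElliptic := by rw [baseChange]; infer_instance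
  obtain ⟨z, hz⟩ := exists_fixedPointFree_two_of_tower W K hK2 hsurj L hLK
  obtain ⟨φ, hrel⟩ := exists_isogeny_cmGenerator W hj hd hcd hodd hoddc L hΔL
  have hη : ∀ (γ : absoluteGaloisGroup L) (P : geomPoints (W.baseChange L)),
      γ • φ.toAddMonoidHom P = φ.toAddMonoidHom (γ • P) := fun γ P ↦ (φ.equivariant γ P).symm
  have hloc : HasLocalPointsMaps (W.baseChange L) (W.baseChange L) φ.toAddMonoidHom := hX φ
  obtain ⟨ηn, hηn, hηnG⟩ := exists_torsionRestrict (W.baseChange L) φ.toAddMonoidHom hη ((2 : ℤ) ^ M)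
  obtain ⟨r, hr⟩ := hodd
  have hrel' : ∀ P : geomPoints (W.baseChange L),
      φ.toAddMonoidHom (φ.toAddMonoidHom P) + (2 * (-r - 1) + 1) • φ.toAddMonoidHom P = (-c) • P := by
    intro P; rw [show (2 * (-r - 1) + 1 : ℤ) = -d by rw [hr]; ring]; exact hrel P
  refine natCard_stable_eq_sq_of_complexConjugation W hΔ hc₀ (restrictNormal_transport_mul_self hc₀)
    (RatClosure.isLiftOfAut_restrictNormal_absGaloisTransport c₀) hrel' hoddc.neg hη hz M ηn hηn hηnG
    (selmerGroup (W.baseChange L) ((2 : ℤ) ^ M)) (fun x hx ↦ conjAct_mem_selmerGroup W hLc _ _ hx)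
    fun x hx ↦ ?_
  exact resH1Hom_mem_selmerGroup_of_hasLocalPointsMaps (W.baseChange L) _ φ.toAddMonoidHom φ.equivariant
    hloc ηn hηn hηnG hx

end TowerIsogeny

end Summit.BirchSwinnertonDyer.BirchSwinnertonDyer.Theorems.InertOrderSplittingHabitat
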